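import Summits.CriticalPhenomena.PercolationContinuityZ3.Theses.PercNearOneGluing
import Summits.CriticalPhenomena.PercolationContinuityZ3.Theorems.PercNearOneGluingAdditiveGluingML5EdgeIdentity
import HarnessLib

/-!
# Crux `PercNearOneGluing.AdditiveGluing` (stmt-CriticalPhenomena-4576), line `tieline`: anatomy of the set-gluing kernel
# (K₀-set) — the exact split `Ψ = P^D − Q^D + Γ_{s₀} − Γ` and the reduction (K₀-set) ⟸ (β-set) + (X_A)

Support file (`--supports stmt-CriticalPhenomena-4576`, helper; seat (d) exchange-certificate form, gen 12; memo K0SET-ANATOMY-g12.md on the item).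
No definitions, no named facts, no sorries.

Setting (the registered stub `stub_k0set3_g2`): weighted graph on `Fin n`, glued set `S = insert s₀ R` (`s₀` the `τ`-minimiser,
`τ(x) = μ(x↔b)`), spectator `c ∉ S`, observer `o`, target `b`.  Events: `yR = ⋃_{r∈R} {y↔r}`, `BR = ⋃_{r∈R} {r↔b}`, `BS = ⋃_{s∈S} {s↔b}`,
`D = (s₀R)ᶜ = {s₀ ↮ R}`, `N = (cS)ᶜ`, `NJ = N ∩ {o↔c}`, and for a vertex `y`
* `Γ^S_y = {y↮b} ∩ yS ∩ BS` (the gluing gain of `y` w.r.t. `S`), `Γ_y = {y↮b} ∩ yR ∩ BR` (w.r.t. `R`: `y` and `b` hang on different `R`-clusters),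
* `P^D_y = D ∩ BR ∩ {y↮s₀}`, `Q^D_y = D ∩ {s₀↔b} ∩ yR`, `a_y = D ∩ yR`.
(K₀-set) is `μ(NJ)·Ψ(c) ≤ μ(N)·Ψ(o)` with `Ψ(y) = μ(BS) − τ(s₀) − μ(Γ^S_y)`.

THIS FILE:
* `K0SetReduction.real_gainS_eq` — `μ(Γ^S_y) = μ(D ∩ BR ∩ {y↔s₀}) + μ(Q^D_y) + μ(Γ_y)` (three-way disjoint union);
* `K0SetReduction.real_BS_sub_tau_eq` — `μ(BS) − τ(s₀) = μ(D ∩ BR) + μ(Γ_{s₀})`;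
* `K0SetReduction.psi_eq` — **`Ψ(y) = μ(P^D_y) − μ(Q^D_y) + μ(Γ_{s₀}) − μ(Γ_y)`**: (K₀-set) is the PAIR kernel (K₀) of the `R`-glued graph
  (`P^D − Q^D`, cf. `K0OfCovTransfer.real_gain_eq`) corrected by the split-attachment probabilities `Γ`;
* `K0SetReduction.k0set_of_XA_betaSet` — **(K₀-set) at an instance from two transfer inequalities at that instance**:
  (β-set) `μ(N)μ(Q^D_o) − μ(NJ)μ(Q^D_c) ≤ ρ·Σ` and
  (X_A)  `ρ·Σ ≤ [μ(N)μ(P^D_o) − μ(NJ)μ(P^D_c)] + [(μ(N) − μ(NJ))μ(Γ_{s₀}) − (μ(N)μ(Γ_o) − μ(NJ)μ(Γ_c))]`,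
  where `Σ = μ(N)μ(a_o) − μ(NJ)μ(a_c)` and `ρ` is any real (intended: `μ(D ∩ {s₀↔b})/μ(D)`).  (β-set) is the covariance-transfer principle
  (UCT) for the glued owner `R` (the shape of `K0CovTransferQ.uct_at` in the `R`-glued weighting); (X_A) is the residual set kernel —
  0 violations on graphs and on hypergraph percolation in the seat's censuses (memo §5), unproved; for `|R| = 1` it is (α) of
  `K0CovTransferPOfQ` weakened by the τ-order.
[cite: KozmaNitzan2024, Lemma 4 (p. 9), Question 7 (p. 36), §5.3 (p. 34)] [cite: VandenbergHaggstromKahn2005, Thm. 1.5 (p. 7), §2.1]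
-/

namespace Summit.CriticalPhenomena.PercolationContinuityZ3.Cruxes.AdditiveGluing.TieLine

open MeasureTheory Set Literature.Probability.LatticeModels Literature.Probability.Percolation
open Summit.CriticalPhenomena.PercolationContinuityZ3.Theorems

noncomputable section
open Classical

namespace K0SetReduction

variable {n : ℕ}

/-! ### Set identities -/

/-- `μ(A ∪ B) = μ(A) + μ(B ∩ Aᶜ)`. [folklore] -/
theorem real_union_eq (w : Sym2 (Fin n) → unitInterval) (A B : Set (BondConfig (Fin n))) :
    (prodBernoulli w).real (A ∪ B) = (prodBernoulli w).real A + (prodBernoulli w).real (B ∩ Aᶜ) := by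
  rw [← Set.union_sdiff_self, measureReal_union disjoint_sdiff_right (Set.toFinite _).measurableSet, Set.sdiff_eq]

/-- **The gluing gain of `y` w.r.t. `S = insert s₀ R` splits three ways**:
`Γ^S_y = [D ∩ BR ∩ {y↔s₀}] ∪ [D ∩ {s₀↔b} ∩ yR] ∪ Γ_y`, `D = {s₀ ↮ R}` (the three pieces are pairwise disjoint, see below).
[cite: KozmaNitzan2024, Lemma 4 (p. 9)] -/
theorem gainS_eq (R : Finset (Fin n)) (s₀ y b : Fin n) :
    ((openConn y b)ᶜ ∩ (⋃ s ∈ insert s₀ R, (openConn y s : Set (BondConfig (Fin n)))) ∩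
        (⋃ s ∈ insert s₀ R, (openConn s b : Set (BondConfig (Fin n))))) =
      ((⋃ r ∈ R, (openConn s₀ r : Set (BondConfig (Fin n))))ᶜ ∩ (⋃ r ∈ R, (openConn r b : Set (BondConfig (Fin n)))) ∩
          openConn y s₀) ∪
        ((⋃ r ∈ R, (openConn s₀ r : Set (BondConfig (Fin n))))ᶜ ∩ openConn s₀ b ∩
          (⋃ r ∈ R, (openConn y r : Set (BondConfig (Fin n))))) ∪
        ((openConn y b)ᶜ ∩ (⋃ r ∈ R, (openConn y r : Set (BondConfig (Fin n)))) ∩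
          (⋃ r ∈ R, (openConn r b : Set (BondConfig (Fin n))))) := by
  ext ω
  simp only [Finset.set_biUnion_insert, mem_inter_iff, mem_union, mem_compl_iff, mem_iUnion, exists_prop, openConn,
    mem_setOf_eq]
  constructor
  · rintro ⟨⟨hyb, hyS⟩, hbS⟩
    by_cases hbR : ∃ r ∈ R, (openGraph ω).Reachable r b
    · by_cases hyR : ∃ r ∈ R, (openGraph ω).Reachable y r
      · exact Or.inr ⟨⟨hyb, hyR⟩, hbR⟩
      · have hys₀ : (openGraph ω).Reachable y s₀ := by
          rcases hyS with h | h
          · exact h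
          · exact absurd h hyR
        refine Or.inl (Or.inl ⟨⟨?_, hbR⟩, hys₀⟩)
        rintro ⟨r, hr, hs₀r⟩
        exact hyR ⟨r, hr, hys₀.trans hs₀r⟩
    · have hs₀b : (openGraph ω).Reachable s₀ b := by
        rcases hbS with h | h
        · exact h
        · exact absurd h hbR
      have hyR : ∃ r ∈ R, (openGraph ω).Reachable y r := by
        rcases hyS with h | h
        · exact absurd (h.trans hs₀b) hyb
        · exact h
      refine Or.inl (Or.inr ⟨⟨?_, hs₀b⟩, hyR⟩)
      rintro ⟨r, hr, hs₀r⟩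
      exact hbR ⟨r, hr, hs₀r.symm.trans hs₀b⟩
  · rintro ((⟨⟨hD, ⟨r, hr, hrb⟩⟩, hys₀⟩ | ⟨⟨hD, hs₀b⟩, ⟨r, hr, hyr⟩⟩) | ⟨⟨hyb, hyR⟩, hbR⟩)
    · refine ⟨⟨fun hyb => hD ⟨r, hr, (hys₀.symm.trans hyb).trans hrb.symm⟩, Or.inl hys₀⟩, Or.inr ⟨r, hr, hrb⟩⟩
    · refine ⟨⟨fun hyb => hD ⟨r, hr, (hs₀b.trans hyb.symm).trans hyr⟩, Or.inr ⟨r, hr, hyr⟩⟩, Or.inl hs₀b⟩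
    · exact ⟨⟨hyb, Or.inr hyR⟩, Or.inr hbR⟩

/-- The first two pieces of `Γ^S_y` are disjoint (`b ↔ R` vs. `b ↮ R`). [folklore] -/
theorem gainS_disjoint₁₂ (R : Finset (Fin n)) (s₀ y b : Fin n) :
    Disjoint
      ((⋃ r ∈ R, (openConn s₀ r : Set (BondConfig (Fin n))))ᶜ ∩ (⋃ r ∈ R, (openConn r b : Set (BondConfig (Fin n)))) ∩
        openConn y s₀)
      ((⋃ r ∈ R, (openConn s₀ r : Set (BondConfig (Fin n))))ᶜ ∩ openConn s₀ b ∩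
        (⋃ r ∈ R, (openConn y r : Set (BondConfig (Fin n))))) := by
  rw [Set.disjoint_left]
  intro ω h1 h2
  simp only [mem_inter_iff, mem_compl_iff, mem_iUnion, exists_prop, openConn, mem_setOf_eq] at h1 h2
  obtain ⟨⟨hD, r, hr, hrb⟩, _⟩ := h1
  exact hD ⟨r, hr, h2.1.2.trans hrb.symm⟩

/-- The union of the first two pieces of `Γ^S_y` is disjoint from the third (`D ∩ {y↔s₀}` forces `y ↮ R`; `D ∩ {s₀↔b}` forces
`b ↮ R`). [folklore] -/
theorem gainS_disjoint₃ (R : Finset (Fin n)) (s₀ y b : Fin n) :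
    Disjoint
      (((⋃ r ∈ R, (openConn s₀ r : Set (BondConfig (Fin n))))ᶜ ∩ (⋃ r ∈ R, (openConn r b : Set (BondConfig (Fin n)))) ∩
          openConn y s₀) ∪
        ((⋃ r ∈ R, (openConn s₀ r : Set (BondConfig (Fin n))))ᶜ ∩ openConn s₀ b ∩
          (⋃ r ∈ R, (openConn y r : Set (BondConfig (Fin n))))))
      ((openConn y b)ᶜ ∩ (⋃ r ∈ R, (openConn y r : Set (BondConfig (Fin n)))) ∩
        (⋃ r ∈ R, (openConn r b : Set (BondConfig (Fin n))))) := by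
  rw [Set.disjoint_left]
  intro ω h12 h3
  simp only [mem_union, mem_inter_iff, mem_compl_iff, mem_iUnion, exists_prop, openConn, mem_setOf_eq] at h12 h3
  obtain ⟨⟨_, r, hr, hyr⟩, r', hr', hr'b⟩ := h3
  rcases h12 with ⟨⟨hD, _⟩, hys₀⟩ | ⟨⟨hD, hs₀b⟩, _⟩
  · exact hD ⟨r, hr, hys₀.symm.trans hyr⟩
  · exact hD ⟨r', hr', hs₀b.trans hr'b.symm⟩

/-- **`μ(Γ^S_y) = μ(D ∩ BR ∩ {y↔s₀}) + μ(D ∩ {s₀↔b} ∩ yR) + μ(Γ_y)`.** [cite: KozmaNitzan2024, Lemma 4 (p. 9)] -/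
theorem real_gainS_eq (w : Sym2 (Fin n) → unitInterval) (R : Finset (Fin n)) (s₀ y b : Fin n) :
    (prodBernoulli w).real ((openConn y b)ᶜ ∩ (⋃ s ∈ insert s₀ R, (openConn y s : Set (BondConfig (Fin n)))) ∩
        (⋃ s ∈ insert s₀ R, (openConn s b : Set (BondConfig (Fin n))))) =
      (prodBernoulli w).real ((⋃ r ∈ R, (openConn s₀ r : Set (BondConfig (Fin n))))ᶜ ∩
            (⋃ r ∈ R, (openConn r b : Set (BondConfig (Fin n)))) ∩ openConn y s₀) +
        (prodBernoulli w).real ((⋃ r ∈ R, (openConn s₀ r : Set (BondConfig (Fin n))))ᶜ ∩ openConn s₀ b ∩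
            (⋃ r ∈ R, (openConn y r : Set (BondConfig (Fin n))))) +
        (prodBernoulli w).real ((openConn y b)ᶜ ∩ (⋃ r ∈ R, (openConn y r : Set (BondConfig (Fin n)))) ∩
            (⋃ r ∈ R, (openConn r b : Set (BondConfig (Fin n))))) := by
  rw [gainS_eq, measureReal_union (gainS_disjoint₃ R s₀ y b) (Set.toFinite _).measurableSet,
    measureReal_union (gainS_disjoint₁₂ R s₀ y b) (Set.toFinite _).measurableSet]

/-- **`μ(BS) − τ(s₀) = μ(D ∩ BR) + μ(Γ_{s₀})`**: the gluing gain of the weakest relay splits into the part where `s₀` is detached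
from `R` and the split-attachment part `Γ_{s₀} = {s₀↮b} ∩ s₀R ∩ BR`. [cite: KozmaNitzan2024, Lemma 4 (p. 9)] -/
theorem real_BS_sub_tau_eq (w : Sym2 (Fin n) → unitInterval) (R : Finset (Fin n)) (s₀ b : Fin n) :
    (prodBernoulli w).real (⋃ s ∈ insert s₀ R, (openConn s b : Set (BondConfig (Fin n)))) -
        (prodBernoulli w).real (openConn s₀ b) =
      (prodBernoulli w).real ((⋃ r ∈ R, (openConn s₀ r : Set (BondConfig (Fin n))))ᶜ ∩
          (⋃ r ∈ R, (openConn r b : Set (BondConfig (Fin n))))) +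
        (prodBernoulli w).real ((openConn s₀ b)ᶜ ∩ (⋃ r ∈ R, (openConn s₀ r : Set (BondConfig (Fin n)))) ∩
          (⋃ r ∈ R, (openConn r b : Set (BondConfig (Fin n))))) := by
  rw [Finset.set_biUnion_insert, real_union_eq,
    ML5EdgeIdentity.real_eq_inter_add_inter_compl w ((⋃ r ∈ R, (openConn r b : Set (BondConfig (Fin n)))) ∩ (openConn s₀ b)ᶜ)
      (⋃ r ∈ R, (openConn s₀ r : Set (BondConfig (Fin n))))]
  have e1 : ((⋃ r ∈ R, (openConn r b : Set (BondConfig (Fin n)))) ∩ (openConn s₀ b)ᶜ ∩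
      (⋃ r ∈ R, (openConn s₀ r : Set (BondConfig (Fin n))))ᶜ) =
      (⋃ r ∈ R, (openConn s₀ r : Set (BondConfig (Fin n))))ᶜ ∩ (⋃ r ∈ R, (openConn r b : Set (BondConfig (Fin n)))) := by
    ext ω
    simp only [mem_inter_iff, mem_compl_iff, mem_iUnion, exists_prop, openConn, mem_setOf_eq]
    constructor
    · rintro ⟨⟨hbR, _⟩, hD⟩; exact ⟨hD, hbR⟩
    · rintro ⟨hD, hbR⟩
      refine ⟨⟨hbR, fun hs₀b => ?_⟩, hD⟩
      obtain ⟨r, hr, hrb⟩ := hbR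
      exact hD ⟨r, hr, hs₀b.trans hrb.symm⟩
  have e2 : ((⋃ r ∈ R, (openConn r b : Set (BondConfig (Fin n)))) ∩ (openConn s₀ b)ᶜ ∩
      (⋃ r ∈ R, (openConn s₀ r : Set (BondConfig (Fin n))))) =
      (openConn s₀ b)ᶜ ∩ (⋃ r ∈ R, (openConn s₀ r : Set (BondConfig (Fin n)))) ∩
        (⋃ r ∈ R, (openConn r b : Set (BondConfig (Fin n)))) := by
    ext ω
    simp only [mem_inter_iff, mem_compl_iff]
    tauto
  rw [e1, e2]
  ring

/-- **`Ψ(y) = μ(P^D_y) − μ(Q^D_y) + μ(Γ_{s₀}) − μ(Γ_y)`** (file header): the set kernel quantity is the glued pair quantity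
`P^D − Q^D` plus the split-attachment correction. [cite: KozmaNitzan2024, Lemma 4 (p. 9), Question 7 (p. 36)] -/
theorem psi_eq (w : Sym2 (Fin n) → unitInterval) (R : Finset (Fin n)) (s₀ y b : Fin n) :
    (prodBernoulli w).real (⋃ s ∈ insert s₀ R, (openConn s b : Set (BondConfig (Fin n)))) -
          (prodBernoulli w).real (openConn s₀ b) -
        (prodBernoulli w).real ((openConn y b)ᶜ ∩ (⋃ s ∈ insert s₀ R, (openConn y s : Set (BondConfig (Fin n)))) ∩
          (⋃ s ∈ insert s₀ R, (openConn s b : Set (BondConfig (Fin n))))) =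
      (prodBernoulli w).real ((⋃ r ∈ R, (openConn s₀ r : Set (BondConfig (Fin n))))ᶜ ∩
            (⋃ r ∈ R, (openConn r b : Set (BondConfig (Fin n)))) ∩ (openConn y s₀)ᶜ) -
          (prodBernoulli w).real ((⋃ r ∈ R, (openConn s₀ r : Set (BondConfig (Fin n))))ᶜ ∩ openConn s₀ b ∩
            (⋃ r ∈ R, (openConn y r : Set (BondConfig (Fin n))))) +
        (prodBernoulli w).real ((openConn s₀ b)ᶜ ∩ (⋃ r ∈ R, (openConn s₀ r : Set (BondConfig (Fin n)))) ∩
            (⋃ r ∈ R, (openConn r b : Set (BondConfig (Fin n))))) -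
        (prodBernoulli w).real ((openConn y b)ᶜ ∩ (⋃ r ∈ R, (openConn y r : Set (BondConfig (Fin n)))) ∩
            (⋃ r ∈ R, (openConn r b : Set (BondConfig (Fin n))))) := by
  rw [real_BS_sub_tau_eq, real_gainS_eq,
    ML5EdgeIdentity.real_eq_inter_add_inter_compl w ((⋃ r ∈ R, (openConn s₀ r : Set (BondConfig (Fin n))))ᶜ ∩
      (⋃ r ∈ R, (openConn r b : Set (BondConfig (Fin n))))) (openConn y s₀)]
  ring

/-! ### The reduction -/

/-- Pure algebra of the reduction: with `Ψ_y = P_y − Q_y + Γ₀ − Γ_y`, (β-set) `N Q_o − NJ Q_c ≤ ρS` and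
(X_A) `ρS ≤ (N P_o − NJ P_c) + ((N − NJ)Γ₀ − (N Γ_o − NJ Γ_c))` give `NJ·Ψ_c ≤ N·Ψ_o`. [folklore] -/
theorem alg {N NJ Po Pc Qo Qc Γ₀ Γo Γc ρS : ℝ}
    (hβ : N * Qo - NJ * Qc ≤ ρS) (hX : ρS ≤ (N * Po - NJ * Pc) + ((N - NJ) * Γ₀ - (N * Γo - NJ * Γc))) :
    NJ * (Pc - Qc + Γ₀ - Γc) ≤ N * (Po - Qo + Γ₀ - Γo) := by
  nlinarith [hβ, hX]

/-- **(K₀-set) at an instance ⟸ (β-set) + (X_A) at that instance.**  For `S ∋ s₀` write `R = S.erase s₀`; all events as in the file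
header.  Hypotheses: `hβ` (the glued-owner covariance transfer, UCT shape) and `hXA` (the residual set kernel), with a free real `ρS`
standing for `(μ(D ∩ s₀↔b)/μ(D))·(μ(N)μ(a_o) − μ(NJ)μ(a_c))`.  Conclusion: the registered stub `stub_k0set3_g2` at `(n, w, S, o, b, c, s₀)`
(its hypotheses `3 ≤ |S|`, `c ∉ S`, τ-order are not needed for this algebraic step; they are where `hβ`, `hXA` come from).
[cite: KozmaNitzan2024, Lemma 4 (p. 9), Question 7 (p. 36), §5.3 (p. 34)] -/
theorem k0set_of_XA_betaSet (w : Sym2 (Fin n) → unitInterval) (S : Finset (Fin n)) (o b c s₀ : Fin n) (hs₀ : s₀ ∈ S) (ρS : ℝ)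
    (hβ : (prodBernoulli w).real ((⋃ s ∈ S, (openConn c s : Set (BondConfig (Fin n))))ᶜ) *
          (prodBernoulli w).real ((⋃ r ∈ S.erase s₀, (openConn s₀ r : Set (BondConfig (Fin n))))ᶜ ∩ openConn s₀ b ∩
            (⋃ r ∈ S.erase s₀, (openConn o r : Set (BondConfig (Fin n))))) -
        (prodBernoulli w).real ((⋃ s ∈ S, (openConn c s : Set (BondConfig (Fin n))))ᶜ ∩ openConn o c) *
          (prodBernoulli w).real ((⋃ r ∈ S.erase s₀, (openConn s₀ r : Set (BondConfig (Fin n))))ᶜ ∩ openConn s₀ b ∩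
            (⋃ r ∈ S.erase s₀, (openConn c r : Set (BondConfig (Fin n))))) ≤ ρS)
    (hXA : ρS ≤
      ((prodBernoulli w).real ((⋃ s ∈ S, (openConn c s : Set (BondConfig (Fin n))))ᶜ) *
          (prodBernoulli w).real ((⋃ r ∈ S.erase s₀, (openConn s₀ r : Set (BondConfig (Fin n))))ᶜ ∩
            (⋃ r ∈ S.erase s₀, (openConn r b : Set (BondConfig (Fin n)))) ∩ (openConn o s₀)ᶜ) -
        (prodBernoulli w).real ((⋃ s ∈ S, (openConn c s : Set (BondConfig (Fin n))))ᶜ ∩ openConn o c) *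
          (prodBernoulli w).real ((⋃ r ∈ S.erase s₀, (openConn s₀ r : Set (BondConfig (Fin n))))ᶜ ∩
            (⋃ r ∈ S.erase s₀, (openConn r b : Set (BondConfig (Fin n)))) ∩ (openConn c s₀)ᶜ)) +
      (((prodBernoulli w).real ((⋃ s ∈ S, (openConn c s : Set (BondConfig (Fin n))))ᶜ) -
          (prodBernoulli w).real ((⋃ s ∈ S, (openConn c s : Set (BondConfig (Fin n))))ᶜ ∩ openConn o c)) *
          (prodBernoulli w).real ((openConn s₀ b)ᶜ ∩ (⋃ r ∈ S.erase s₀, (openConn s₀ r : Set (BondConfig (Fin n)))) ∩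
            (⋃ r ∈ S.erase s₀, (openConn r b : Set (BondConfig (Fin n))))) -
        ((prodBernoulli w).real ((⋃ s ∈ S, (openConn c s : Set (BondConfig (Fin n))))ᶜ) *
            (prodBernoulli w).real ((openConn o b)ᶜ ∩ (⋃ r ∈ S.erase s₀, (openConn o r : Set (BondConfig (Fin n)))) ∩
              (⋃ r ∈ S.erase s₀, (openConn r b : Set (BondConfig (Fin n))))) -
          (prodBernoulli w).real ((⋃ s ∈ S, (openConn c s : Set (BondConfig (Fin n))))ᶜ ∩ openConn o c) *
            (prodBernoulli w).real ((openConn c b)ᶜ ∩ (⋃ r ∈ S.erase s₀, (openConn c r : Set (BondConfig (Fin n)))) ∩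
              (⋃ r ∈ S.erase s₀, (openConn r b : Set (BondConfig (Fin n)))))))) :
    (prodBernoulli w).real ((⋃ s ∈ S, (openConn c s : Set (BondConfig (Fin n))))ᶜ ∩ openConn o c) *
        ((prodBernoulli w).real (⋃ s ∈ S, (openConn s b : Set (BondConfig (Fin n)))) -
          (prodBernoulli w).real (openConn s₀ b) -
          (prodBernoulli w).real ((openConn c b)ᶜ ∩ (⋃ s ∈ S, (openConn c s : Set (BondConfig (Fin n)))) ∩
            (⋃ s ∈ S, (openConn s b : Set (BondConfig (Fin n)))))) ≤
      (prodBernoulli w).real ((⋃ s ∈ S, (openConn c s : Set (BondConfig (Fin n))))ᶜ) *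
        ((prodBernoulli w).real (⋃ s ∈ S, (openConn s b : Set (BondConfig (Fin n)))) -
          (prodBernoulli w).real (openConn s₀ b) -
          (prodBernoulli w).real ((openConn o b)ᶜ ∩ (⋃ s ∈ S, (openConn o s : Set (BondConfig (Fin n)))) ∩
            (⋃ s ∈ S, (openConn s b : Set (BondConfig (Fin n)))))) := by
  have hS : S = insert s₀ (S.erase s₀) := (Finset.insert_erase hs₀).symm
  generalize hR : S.erase s₀ = R at hβ hXA hS
  subst hS
  rw [psi_eq w R s₀ c b, psi_eq w R s₀ o b]
  exact alg hβ hXA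

end K0SetReduction

end

end Summit.CriticalPhenomena.PercolationContinuityZ3.Cruxes.AdditiveGluing.TieLine
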